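import Literature.AnabelianGeometry.AbsoluteAnabelian.ZHatCompletionFreeProcyclic
import Literature.AnabelianGeometry.EtaleTheta.Cyclotome
import Mathlib.Algebra.Group.Basic
import HarnessLib

/-!
# The `Ẑ^×`-action on cyclotomes `Λ(A) = lim_n A[n]`

Source for the object: LANA Project interim report (July 2026) [LANA2026Report], §6.1 "Generalities on Kummer
maps", p. 31: `Λ(M) := lim_{← n} M^gp[n]` "considered as a (topological) `G`-module" — the tree's
`Literature.AnabelianGeometry.EtaleTheta.cyclotome` (`Cyclotome.lean`), whose docstring records: "the
`Ẑ^×`-action on `Λ` and the profinite topology are not formalised here". Source for `Ẑ`: classical profinite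
group theory [RibesZalesskii2010, Thm 2.7.1] (`Ẑ = lim ℤ/nℤ`, `ℤ` dense, `nẐ` the open subgroup of index `n`),
over Mathlib's `ProfiniteGrp.ProfiniteCompletion.completion (GrpCat.of (Multiplicative ℤ))` = the tree's
`SemiGraphs.ZHat` / `IUT.HodgeTheaters.ZHat` (both `abbrev`s of this term) and the tree's bridge file
`ZHatCompletionFreeProcyclic.lean` (abc-iut-L4).

This file makes the `Ẑ^×`-MODULE STRUCTURE of a cyclotome REAL (classical, undisputed; no named fact):

* `ZHatLevel.level n : Ẑ →* ℤ/nℤ` (multiplicatively written) — the level-`n` character of the completion,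
  `level_eta` (`η(k) ↦ k mod n`), `isOpen_ker_level`, the compatibility `cast_level_mul` (`ℤ/nm → ℤ/n`);
* `ZHatLevel.level_eq_one_iff_exists_pow` — **`Ker(Ẑ → ℤ/nℤ) = Ẑ^n`** (the `n`-th powers): the image of the
  continuous `n`-th power map of the compact group `Ẑ` is closed and contains `η(nℤ)`, which is dense in the open
  kernel because `η(ℤ)` is dense in `Ẑ`;
* `ZHatLevel.level_map` — consequently EVERY endomorphism `φ` of the abstract group `Ẑ` acts on `ℤ/nℤ` through
  multiplication by `level n (φ(η 1))` (so, in particular, every abstract automorphism of `Ẑ` is "continuous at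
  every finite level"); `ZHatLevel.levelChar n : Aut(Ẑ) →* ℤ/nℤ` — the level-`n` CYCLOTOMIC CHARACTER of
  `Ẑ^× = Aut(Ẑ)` (the tree's `ZHatUnits := MulAut ZHat`, [IUTchII] Ex. 1.8 (iii)), multiplicative, compatible in
  `n` (`cast_levelChar_mul`);
* `cyclotome.zhatTwist A : Aut(Ẑ) →* MulAut (Λ(A))` — **the `Ẑ^×`-action on the cyclotome** of any commutative
  group `A`: `(u · ζ)_n = ζ_n ^ (χ_n(u))` (`zhatTwist_apply_coe`); a group action by group automorphisms (PROVED);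
  NATURAL in `A` (`map_zhatTwist`: `Λ(f)` is `Ẑ^×`-equivariant for every `f : A →* B`) and commuting with any
  `G`-module structure (`smul_zhatTwist`).

Consumers: [IUTchII] Cor. 1.11 (a) "the `Γ`-orbit (`Γ ⊆ Ẑ^×`) of the cyclotomic rigidity isomorphism" /
Rmk. 1.11.1 (i)(b) "the natural action of `Ẑ^×`" (abc-iut-L6-t1 `GaloisPairRigidityData.twist`, the input
`GalTwistInput` of the B12 bridge `GaloisPairCyclotomesBridge.lean`), [AbsAnab] Prop. 1.2.1 (vi) (the cyclotomic
character). HONEST FRAMING: classical bookkeeping; nothing here bears on [IUTchIII] Cor. 3.12.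
-/

noncomputable section

open CategoryTheory ProfiniteGrp ProfiniteGrp.ProfiniteCompletion Topology

namespace Literature.AnabelianGeometry.EtaleTheta

/-! ## Level characters of `Ẑ` -/

namespace ZHatLevel

/-- `η(k) ∈ Ẑ`, the image of the integer `k` in the profinite completion. [cite: RibesZalesskii2010, Thm 2.7.1] -/
abbrev eta (k : ℤ) : completion (GrpCat.of (Multiplicative ℤ)) :=
  etaFn (GrpCat.of (Multiplicative ℤ)) (Multiplicative.ofAdd k)

/-- `η(k) = η(1)^k`. [cite: RibesZalesskii2010, Thm 2.7.1] -/
theorem eta_eq_zpow (k : ℤ) : eta k = eta 1 ^ k :=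
  Literature.AnabelianGeometry.AbsoluteAnabelian.ZHatCompletion.etaFn_ofAdd k

/-- The reduction `ℤ → ℤ/nℤ`, as a homomorphism of multiplicative groups. [cite: RibesZalesskii2010, Thm 2.7.1] -/
def castMul (n : ℕ+) : Multiplicative ℤ →* Multiplicative (ZMod n) :=
  (Int.castAddHom (ZMod n) : ℤ →+ ZMod n).toMultiplicative

/-- `castMul n (ofAdd k) = ofAdd (k mod n)`. [cite: RibesZalesskii2010, Thm 2.7.1] -/
@[simp] theorem castMul_apply (n : ℕ+) (k : Multiplicative ℤ) :
    castMul n k = Multiplicative.ofAdd ((Multiplicative.toAdd k : ℤ) : ZMod n) := rfl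

/-- `ℤ → ℤ/nℤ` is surjective. [cite: RibesZalesskii2010, Thm 2.7.1] -/
theorem castMul_surjective (n : ℕ+) : Function.Surjective (castMul n) := fun y => by
  obtain ⟨k, hk⟩ := ZMod.intCast_surjective (Multiplicative.toAdd y)
  exact ⟨Multiplicative.ofAdd k, by rw [castMul_apply, toAdd_ofAdd, hk, ofAdd_toAdd]⟩

/-- `nℤ = Ker(ℤ → ℤ/nℤ)` has finite index. [cite: RibesZalesskii2010, Thm 2.7.1] -/
theorem finiteIndex_ker_castMul (n : ℕ+) : (castMul n).ker.FiniteIndex := by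
  haveI : NeZero (n : ℕ) := NeZero.of_pos n.pos
  refine ⟨?_⟩
  rw [Subgroup.index_ker, MonoidHom.range_eq_top.mpr (castMul_surjective n)]
  haveI : Finite (Multiplicative (ZMod n)) := inferInstance
  exact Nat.card_pos.ne'

/-- `nℤ ⊆ ℤ` as a finite-index normal subgroup (an index of Mathlib's finite-quotient diagram of `ℤ`).
[cite: RibesZalesskii2010, Thm 2.7.1] -/
def kerLevel (n : ℕ+) : FiniteIndexNormalSubgroup (Multiplicative ℤ) :=
  haveI := finiteIndex_ker_castMul n
  FiniteIndexNormalSubgroup.ofSubgroup (castMul n).ker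

/-- The underlying subgroup of `kerLevel n` is `Ker(ℤ → ℤ/nℤ)`. [cite: RibesZalesskii2010, Thm 2.7.1] -/
theorem kerLevel_toSubgroup (n : ℕ+) : (kerLevel n).toSubgroup = (castMul n).ker := rfl

/-- Membership in `kerLevel n`: `n ∣ k`. [cite: RibesZalesskii2010, Thm 2.7.1] -/
theorem mem_kerLevel_iff (n : ℕ+) (k : Multiplicative ℤ) :
    k ∈ kerLevel n ↔ ((n : ℕ) : ℤ) ∣ Multiplicative.toAdd k := by
  change k ∈ (castMul n).ker ↔ _
  rw [MonoidHom.mem_ker, castMul_apply, ← ofAdd_zero, Multiplicative.ofAdd.injective.eq_iff,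
    ZMod.intCast_zmod_eq_zero_iff_dvd]

/-- `kerLevel (n m) ≤ kerLevel n` (`nmℤ ⊆ nℤ`). [cite: RibesZalesskii2010, Thm 2.7.1] -/
theorem kerLevel_mul_le (n m : ℕ+) : kerLevel (n * m) ≤ kerLevel n := by
  intro k hk
  have hk' : k ∈ kerLevel (n * m) := hk
  rw [mem_kerLevel_iff] at hk' ⊢
  exact dvd_trans ⟨(m : ℕ), by push_cast; ring⟩ hk'

/-- The level-`n` projection `Ẑ → ℤ/nℤ` onto the `kerLevel n`-component of the limit.
[cite: RibesZalesskii2010, Thm 2.7.1] -/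
def proj (n : ℕ+) :
    completion (GrpCat.of (Multiplicative ℤ)) →* Multiplicative ℤ ⧸ (kerLevel n).toSubgroup :=
  MonoidHom.mk' (fun x => (x.val (kerLevel n) : Multiplicative ℤ ⧸ (kerLevel n).toSubgroup)) fun _ _ => rfl

/-- `proj n (η k) = [k]`. [cite: RibesZalesskii2010, Thm 2.7.1] -/
theorem proj_eta (n : ℕ+) (k : ℤ) :
    proj n (eta k) = (QuotientGroup.mk (Multiplicative.ofAdd k) : Multiplicative ℤ ⧸ (kerLevel n).toSubgroup) :=
  rfl

/-- The projections are compatible: `[·]_{n} ∘ proj (n m) = proj n`. [cite: RibesZalesskii2010, Thm 2.7.1] -/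
theorem map_proj_mul (n m : ℕ+) (x : completion (GrpCat.of (Multiplicative ℤ))) :
    QuotientGroup.map (kerLevel (n * m)).toSubgroup (kerLevel n).toSubgroup (MonoidHom.id _)
        (kerLevel_mul_le n m) (proj (n * m) x) = proj n x :=
  x.prop (kerLevel_mul_le n m).hom

/-- `proj n` is continuous for the discrete topology of the finite quotient, i.e. its fibres are open; in
particular its kernel is open. [cite: RibesZalesskii2010, Thm 2.7.1] -/
theorem isOpen_ker_proj (n : ℕ+) :
    IsOpen ((proj n).ker : Set (completion (GrpCat.of (Multiplicative ℤ)))) := by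
  haveI : DiscreteTopology ((diagram (GrpCat.of (Multiplicative ℤ))).obj (kerLevel n)) := ⟨rfl⟩
  have hc : Continuous (proj n) :=
    Literature.AnabelianGeometry.AbsoluteAnabelian.ZHatCompletion.continuous_val (kerLevel n)
  have : ((proj n).ker : Set (completion (GrpCat.of (Multiplicative ℤ)))) = proj n ⁻¹' {1} := by
    ext x; simp [MonoidHom.mem_ker]
  rw [this]
  exact (isOpen_discrete _).preimage hc

/-- **The level-`n` character `Ẑ → ℤ/nℤ`** (written multiplicatively): `proj n` followed by the identification
`ℤ/Ker(ℤ → ℤ/nℤ) ≅ ℤ/nℤ`. [cite: RibesZalesskii2010, Thm 2.7.1] -/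
def level (n : ℕ+) : completion (GrpCat.of (Multiplicative ℤ)) →* Multiplicative (ZMod n) :=
  (QuotientGroup.kerLift (castMul n)).comp (proj n)

/-- `level n (η k) = k mod n`. [cite: RibesZalesskii2010, Thm 2.7.1] -/
@[simp] theorem level_eta (n : ℕ+) (k : ℤ) : level n (eta k) = Multiplicative.ofAdd (k : ZMod n) := by
  change QuotientGroup.kerLift (castMul n) (QuotientGroup.mk (Multiplicative.ofAdd k)) = _
  rw [QuotientGroup.kerLift_mk, castMul_apply, toAdd_ofAdd]

/-- `Ker(level n) = Ker(proj n)`. [cite: RibesZalesskii2010, Thm 2.7.1] -/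
theorem ker_level (n : ℕ+) : (level n).ker = (proj n).ker := by
  ext x
  rw [MonoidHom.mem_ker, MonoidHom.mem_ker]
  change QuotientGroup.kerLift (castMul n) (proj n x) = 1 ↔ _
  constructor
  · intro h
    exact QuotientGroup.kerLift_injective (castMul n) (h.trans (map_one _).symm)
  · intro h
    rw [h]
    exact map_one (QuotientGroup.kerLift (castMul n))

/-- `Ker(Ẑ → ℤ/nℤ)` is open. [cite: RibesZalesskii2010, Thm 2.7.1] -/
theorem isOpen_ker_level (n : ℕ+) :
    IsOpen ((level n).ker : Set (completion (GrpCat.of (Multiplicative ℤ)))) := by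
  rw [ker_level]
  exact isOpen_ker_proj n

/-- Every element of `Ẑ` has the level-`n` value of some integer. [cite: RibesZalesskii2010, Thm 2.7.1] -/
theorem exists_level_eq_level_eta (n : ℕ+) (x : completion (GrpCat.of (Multiplicative ℤ))) :
    ∃ k : ℤ, level n x = level n (eta k) := by
  obtain ⟨k, hk⟩ := ZMod.intCast_surjective (Multiplicative.toAdd (level n x))
  exact ⟨k, by rw [level_eta, hk, ofAdd_toAdd]⟩

/-- Compatibility of the level characters: `(level (n m) x) mod n = level n x`.
[cite: RibesZalesskii2010, Thm 2.7.1] -/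
theorem cast_level_mul (n m : ℕ+) (x : completion (GrpCat.of (Multiplicative ℤ))) :
    (ZMod.castHom (dvd_mul_right (n : ℕ) m) (ZMod n) (Multiplicative.toAdd (level (n * m) x))) =
      Multiplicative.toAdd (level n x) := by
  have hcompat := map_proj_mul n m x
  -- write the level-`nm` component as the class of an integer
  obtain ⟨g, hg⟩ := QuotientGroup.mk_surjective (proj (n * m) x)
  have h1 : level (n * m) x = Multiplicative.ofAdd ((Multiplicative.toAdd g : ℤ) : ZMod (n * m)) := by
    change QuotientGroup.kerLift (castMul (n * m)) (proj (n * m) x) = _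
    rw [← hg]
    exact QuotientGroup.kerLift_mk (castMul (n * m)) g
  have h2 : level n x = Multiplicative.ofAdd ((Multiplicative.toAdd g : ℤ) : ZMod n) := by
    change QuotientGroup.kerLift (castMul n) (proj n x) = _
    rw [← hcompat, ← hg]
    exact QuotientGroup.kerLift_mk (castMul n) g
  rw [h1, h2, toAdd_ofAdd, toAdd_ofAdd, map_intCast]

/-- `level n (z ^ n) = 1`. [cite: RibesZalesskii2010, Thm 2.7.1] -/
theorem level_pow_self (n : ℕ+) (z : completion (GrpCat.of (Multiplicative ℤ))) :
    level n (z ^ (n : ℕ)) = 1 := by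
  rw [map_pow, ← ofAdd_toAdd (level n z), ← ofAdd_nsmul, nsmul_eq_mul, ZMod.natCast_self, zero_mul, ofAdd_zero]

/-- **`Ker(Ẑ → ℤ/nℤ) = Ẑ^n`.** An element of `Ẑ` dies in `ℤ/nℤ` iff it is an `n`-th power: the `n`-th power map
of the compact group `Ẑ` has closed image containing `η(nℤ) = Ker ∩ η(ℤ)`, which is dense in the OPEN kernel since
`η(ℤ)` is dense in `Ẑ`. [cite: RibesZalesskii2010, Thm 2.7.1] -/
theorem level_eq_one_iff_exists_pow (n : ℕ+) (y : completion (GrpCat.of (Multiplicative ℤ))) :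
    level n y = 1 ↔ ∃ z : completion (GrpCat.of (Multiplicative ℤ)), z ^ (n : ℕ) = y := by
  constructor
  · intro hy
    -- the image of the `n`-th power map is closed
    let P : Set (completion (GrpCat.of (Multiplicative ℤ))) := Set.range fun z => z ^ (n : ℕ)
    have hPc : IsClosed P := (isCompact_range (continuous_pow (n : ℕ))).isClosed
    -- the kernel is open, so `η(ℤ) ∩ Ker` is dense in it
    have hK : ((level n).ker : Set (completion (GrpCat.of (Multiplicative ℤ)))) ⊆
        closure (((level n).ker : Set (completion (GrpCat.of (Multiplicative ℤ)))) ∩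
          Set.range (etaFn (GrpCat.of (Multiplicative ℤ)))) :=
      (denseRange (GrpCat.of (Multiplicative ℤ))).open_subset_closure_inter (isOpen_ker_level n)
    -- `η(ℤ) ∩ Ker = η(nℤ) ⊆ P`
    have hsub : ((level n).ker : Set (completion (GrpCat.of (Multiplicative ℤ)))) ∩
        Set.range (etaFn (GrpCat.of (Multiplicative ℤ))) ⊆ P := by
      rintro _ ⟨hx, k, rfl⟩
      have hk : level n (eta (Multiplicative.toAdd k)) = 1 := hx
      rw [level_eta, ← ofAdd_zero, Multiplicative.ofAdd.injective.eq_iff,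
        ZMod.intCast_zmod_eq_zero_iff_dvd] at hk
      obtain ⟨k', hk'⟩ := hk
      refine ⟨eta k', ?_⟩
      change eta k' ^ (n : ℕ) = eta (Multiplicative.toAdd k)
      rw [hk', eta_eq_zpow k', eta_eq_zpow (((n : ℕ) : ℤ) * k'), ← zpow_natCast, ← zpow_mul, mul_comm]
    have hy' : y ∈ ((level n).ker : Set (completion (GrpCat.of (Multiplicative ℤ)))) := hy
    have : y ∈ P := closure_minimal hsub hPc (hK hy')
    exact this
  · rintro ⟨z, rfl⟩
    exact level_pow_self n z

/-- **Every endomorphism of the abstract group `Ẑ` acts on `ℤ/nℤ` by a scalar**: for `φ : Ẑ →* Ẑ`,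
`level n (φ x) = level n (φ (η 1)) · level n x` (write `x = z^n · η(k)` by the previous theorem).
[cite: RibesZalesskii2010, Thm 2.7.1] -/
theorem level_map (n : ℕ+) (φ : completion (GrpCat.of (Multiplicative ℤ)) →* completion (GrpCat.of (Multiplicative ℤ)))
    (x : completion (GrpCat.of (Multiplicative ℤ))) :
    Multiplicative.toAdd (level n (φ x)) =
      Multiplicative.toAdd (level n (φ (eta 1))) * Multiplicative.toAdd (level n x) := by
  obtain ⟨k, hk⟩ := exists_level_eq_level_eta n x
  have h1 : level n (x * (eta k)⁻¹) = 1 := by rw [map_mul, map_inv, hk, mul_inv_cancel]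
  obtain ⟨z, hz⟩ := (level_eq_one_iff_exists_pow n _).mp h1
  have hx : x = z ^ (n : ℕ) * eta k := by rw [hz, inv_mul_cancel_right]
  have hφx : level n (φ x) = level n (φ (eta 1)) ^ k := by
    rw [hx, map_mul, map_mul, map_pow, level_pow_self, one_mul, eta_eq_zpow k, map_zpow, map_zpow]
  have hlx : level n x = Multiplicative.ofAdd (k : ZMod n) := by rw [hk, level_eta]
  rw [hφx, hlx, toAdd_zpow, toAdd_ofAdd, zsmul_eq_mul, mul_comm]

/-- **The level-`n` cyclotomic character of `Ẑ^× = Aut(Ẑ)`**: `χ_n(u) := level n (u(η 1)) ∈ ℤ/nℤ`, a MONOID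
homomorphism `Aut(Ẑ) → (ℤ/nℤ, ·)` (multiplicativity by `level_map`). (`Aut(Ẑ)` = the tree's `ZHatUnits`,
[IUTchII] Ex. 1.8 (iii): "`Aut(Ẑ) = Ẑ^×`".) [cite: RibesZalesskii2010, Thm 2.7.1] -/
def levelChar (n : ℕ+) : MulAut (completion (GrpCat.of (Multiplicative ℤ))) →* ZMod n where
  toFun φ := Multiplicative.toAdd (level n (φ (eta 1)))
  map_one' := by
    change Multiplicative.toAdd (level n (eta 1)) = 1
    rw [level_eta, toAdd_ofAdd, Int.cast_one]
  map_mul' φ ψ := by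
    change Multiplicative.toAdd (level n (φ.toMonoidHom (ψ (eta 1)))) = _
    rw [level_map]
    rfl

/-- Definition of `levelChar`. [cite: RibesZalesskii2010, Thm 2.7.1] -/
theorem levelChar_apply (n : ℕ+) (φ : MulAut (completion (GrpCat.of (Multiplicative ℤ)))) :
    levelChar n φ = Multiplicative.toAdd (level n (φ (eta 1))) := rfl

/-- `u ∈ Aut(Ẑ)` acts on `ℤ/nℤ` through `χ_n(u)`: `level n (u x) = χ_n(u) · level n x`.
[cite: RibesZalesskii2010, Thm 2.7.1] -/
theorem toAdd_level_aut (n : ℕ+) (φ : MulAut (completion (GrpCat.of (Multiplicative ℤ))))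
    (x : completion (GrpCat.of (Multiplicative ℤ))) :
    Multiplicative.toAdd (level n (φ x)) = levelChar n φ * Multiplicative.toAdd (level n x) :=
  level_map n φ.toMonoidHom x

/-- Compatibility of the characters in `n`: `χ_{nm}(u) mod n = χ_n(u)`. [cite: RibesZalesskii2010, Thm 2.7.1] -/
theorem cast_levelChar_mul (n m : ℕ+) (φ : MulAut (completion (GrpCat.of (Multiplicative ℤ)))) :
    ZMod.castHom (dvd_mul_right (n : ℕ) m) (ZMod n) (levelChar (n * m) φ) = levelChar n φ :=
  cast_level_mul n m _

/-- Hence `χ_{nm}(u).val ≡ χ_n(u).val (mod n)`. [cite: RibesZalesskii2010, Thm 2.7.1] -/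
theorem val_levelChar_mul_mod (n m : ℕ+) (φ : MulAut (completion (GrpCat.of (Multiplicative ℤ)))) :
    (levelChar (n * m) φ).val % (n : ℕ) = (levelChar n φ).val := by
  haveI : NeZero ((n * m : ℕ+) : ℕ) := NeZero.of_pos (n * m).pos
  have h := cast_levelChar_mul n m φ
  rw [ZMod.castHom_apply, ZMod.cast_eq_val] at h
  have h' := congrArg ZMod.val h
  rwa [ZMod.val_natCast] at h'

/-- `χ_n` takes values in units: `χ_n(u) · χ_n(u⁻¹) = 1`. [cite: RibesZalesskii2010, Thm 2.7.1] -/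
theorem levelChar_mul_levelChar_inv (n : ℕ+) (φ : MulAut (completion (GrpCat.of (Multiplicative ℤ)))) :
    levelChar n φ * levelChar n φ⁻¹ = 1 := by
  rw [← map_mul, mul_inv_cancel, map_one]

end ZHatLevel

/-! ## The `Ẑ^×`-action on a cyclotome -/

namespace cyclotome

universe u v

variable {A : Type u} [CommGroup A]

/-- A torsion element raised to a `ℤ/nℤ`-valued exponent only depends on the exponent mod `n`.
[cite: LANA2026Report, §6.1 p.31] -/
theorem pow_val_eq_pow_of_mod_eq {a : A} {n : ℕ} (ha : a ^ n = 1) {k l : ℕ} (h : k % n = l % n) :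
    a ^ k = a ^ l := by
  rw [pow_eq_pow_mod k ha, pow_eq_pow_mod l ha, h]

/-- The underlying function of the twist by `u ∈ Aut(Ẑ)`: `(u · ζ)_n := ζ_n ^ χ_n(u)`.
[cite: LANA2026Report, §6.1 p.31] -/
def zhatTwistFun (φ : MulAut (completion (GrpCat.of (Multiplicative ℤ)))) (ζ : cyclotome A) : cyclotome A :=
  ⟨fun n => (ζ : ℕ+ → A) n ^ (ZHatLevel.levelChar n φ).val,
    ⟨fun n => by
        rw [pow_right_comm, cyclotome.pow_eq_one, one_pow],
      fun n m => by
        haveI : NeZero (n : ℕ) := NeZero.of_pos n.pos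
        rw [pow_right_comm, cyclotome.pow_apply_mul]
        exact pow_val_eq_pow_of_mod_eq (cyclotome.pow_eq_one ζ n)
          (by rw [ZHatLevel.val_levelChar_mul_mod, Nat.mod_eq_of_lt (ZMod.val_lt _)])⟩⟩

/-- Components of the twist. [cite: LANA2026Report, §6.1 p.31] -/
@[simp] theorem zhatTwistFun_apply (φ : MulAut (completion (GrpCat.of (Multiplicative ℤ)))) (ζ : cyclotome A)
    (n : ℕ+) : ((zhatTwistFun φ ζ : cyclotome A) : ℕ+ → A) n = (ζ : ℕ+ → A) n ^ (ZHatLevel.levelChar n φ).val :=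
  rfl

/-- The trivial automorphism twists trivially. [cite: LANA2026Report, §6.1 p.31] -/
theorem zhatTwistFun_one (ζ : cyclotome A) : zhatTwistFun 1 ζ = ζ := by
  refine Subtype.ext (funext fun n => ?_)
  rw [zhatTwistFun_apply, map_one, ZMod.val_one_eq_one_mod, ← pow_eq_pow_mod 1 (cyclotome.pow_eq_one ζ n), pow_one]

/-- The twist is multiplicative in `u`: `(u v) · ζ = u · (v · ζ)`. [cite: LANA2026Report, §6.1 p.31] -/
theorem zhatTwistFun_mul (φ ψ : MulAut (completion (GrpCat.of (Multiplicative ℤ)))) (ζ : cyclotome A) :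
    zhatTwistFun (φ * ψ) ζ = zhatTwistFun φ (zhatTwistFun ψ ζ) := by
  refine Subtype.ext (funext fun n => ?_)
  rw [zhatTwistFun_apply, zhatTwistFun_apply, zhatTwistFun_apply, ← pow_mul, map_mul, ZMod.val_mul]
  exact pow_val_eq_pow_of_mod_eq (cyclotome.pow_eq_one ζ n) (by rw [Nat.mod_mod, mul_comm])

/-- The twist is multiplicative in `ζ`. [cite: LANA2026Report, §6.1 p.31] -/
theorem zhatTwistFun_mul_right (φ : MulAut (completion (GrpCat.of (Multiplicative ℤ)))) (ζ ξ : cyclotome A) :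
    zhatTwistFun φ (ζ * ξ) = zhatTwistFun φ ζ * zhatTwistFun φ ξ := by
  refine Subtype.ext (funext fun n => ?_)
  change ((ζ : ℕ+ → A) * (ξ : ℕ+ → A)) n ^ _ = (ζ : ℕ+ → A) n ^ _ * (ξ : ℕ+ → A) n ^ _
  rw [Pi.mul_apply, mul_pow]

variable (A)

/-- **The `Ẑ^×`-action on the cyclotome `Λ(A)`** (`Λ(A) = lim_n A[n]` is a `Ẑ`-module; `Ẑ^× = Aut(Ẑ)` acts by
group automorphisms): `u ↦ (ζ ↦ (ζ_n ^ χ_n(u))_n)`, a homomorphism `Aut(Ẑ) → Aut(Λ(A))`. DEFINED; the action laws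
PROVED. [cite: LANA2026Report, §6.1 p.31] -/
def zhatTwist : MulAut (completion (GrpCat.of (Multiplicative ℤ))) →* MulAut (cyclotome A) where
  toFun φ :=
    { toFun := zhatTwistFun φ
      invFun := zhatTwistFun φ⁻¹
      left_inv := fun ζ => by rw [← zhatTwistFun_mul, inv_mul_cancel, zhatTwistFun_one]
      right_inv := fun ζ => by rw [← zhatTwistFun_mul, mul_inv_cancel, zhatTwistFun_one]
      map_mul' := zhatTwistFun_mul_right φ }
  map_one' := MulEquiv.ext fun ζ => zhatTwistFun_one ζ
  map_mul' φ ψ := MulEquiv.ext fun ζ => zhatTwistFun_mul φ ψ ζ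

variable {A}

/-- Components of the action: `(u · ζ)_n = ζ_n ^ χ_n(u)`. [cite: LANA2026Report, §6.1 p.31] -/
@[simp] theorem zhatTwist_apply_coe (φ : MulAut (completion (GrpCat.of (Multiplicative ℤ)))) (ζ : cyclotome A)
    (n : ℕ+) : ((zhatTwist A φ ζ : cyclotome A) : ℕ+ → A) n = (ζ : ℕ+ → A) n ^ (ZHatLevel.levelChar n φ).val :=
  rfl

/-- **Naturality**: `Λ(f)` is `Ẑ^×`-equivariant for every homomorphism `f : A → B`.
[cite: LANA2026Report, §6.1 p.32] -/
theorem map_zhatTwist {B : Type v} [CommGroup B] (f : A →* B)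
    (φ : MulAut (completion (GrpCat.of (Multiplicative ℤ)))) (ζ : cyclotome A) :
    cyclotome.map f (zhatTwist A φ ζ) = zhatTwist B φ (cyclotome.map f ζ) :=
  Subtype.ext (funext fun n => by simp [map_pow])

/-- The `Ẑ^×`-action commutes with any `G`-module structure on `A` ("considered as a `G`-module").
[cite: LANA2026Report, §6.1 p.31] -/
theorem smul_zhatTwist {G : Type*} [Group G] [MulDistribMulAction G A] (g : G)
    (φ : MulAut (completion (GrpCat.of (Multiplicative ℤ)))) (ζ : cyclotome A) :
    g • zhatTwist A φ ζ = zhatTwist A φ (g • ζ) :=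
  Subtype.ext (funext fun n => by
    rw [cyclotome.smul_apply, zhatTwist_apply_coe, zhatTwist_apply_coe, cyclotome.smul_apply, smul_pow'])

/-- A `Ẑ^×`-EQUIVARIANCE transfer: any group isomorphism `e : Λ(A) ≃* Λ(B)` that is componentwise (of the form
`Λ(f)` on elements) commutes with the twists. [cite: LANA2026Report, §6.1 p.32] -/
theorem mapEquiv_zhatTwist_of_eq_map {B : Type v} [CommGroup B] (e : cyclotome A ≃* cyclotome B) (f : A →* B)
    (he : ∀ ζ, e ζ = cyclotome.map f ζ) (φ : MulAut (completion (GrpCat.of (Multiplicative ℤ))))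
    (ζ : cyclotome A) : e (zhatTwist A φ ζ) = zhatTwist B φ (e ζ) := by
  rw [he, he, map_zhatTwist]

end cyclotome

end Literature.AnabelianGeometry.EtaleTheta

end
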